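import Summits.HodgeConjecture.HodgeConjecture.Theses.SiuRepresentability
import HarnessLib

/-!
# Route SiuRepresentability — the glue item `KaehlerRepresentableOfSectors` (stmt-HodgeConjecture-18537), proved

`KaehlerRepresentableOfSectors := IndecomposableRepresentable → RepresentableCupHodge → KaehlerRepresentable`
is the assembly of the crux-strategist's typed split of the deciding crux `KaehlerRepresentable`
(stmt-HodgeConjecture-9029) into its indecomposable sector (`IndecomposableRepresentable`,
stmt-HodgeConjecture-18155) and its decomposable sector in hereditary form (`RepresentableCupHodge`,
stmt-HodgeConjecture-18156). This file closes it BY NAME: strong induction on the codimension `p` — a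
decomposable generator `a ∪ b` of codimension `p` has its first factor of codimension `i < p`, which is
a divisor class by Lefschetz's theorem on `(1,1)`-classes when `i = 1` (the route's proved item, used
through `LefschetzOneOne_holds`) and lies in the span of the Kähler-representable classes by the
induction hypothesis when `i ≥ 2`; linearity of `∪` in that factor (`Submodule.map₂_span_span`) then
puts `a ∪ b` in the span of the products (algebraic-or-representable) `∪` (rational Hodge), which
`RepresentableCupHodge` sends into the representable span. Identical, up to unfolding the three
route decls, to `Cruxes/KaehlerRepresentable/StrategySplit.lean` (`kaehlerRepresentable_of_subs`,
seat planner-cstrat-stmt-HodgeConjecture-9029-r1-0, 2026-08-17). No `def`s; unconditional; standard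
axioms; no named facts.
-/

noncomputable section

set_option linter.dupNamespace false

open scoped Manifold ContinuousMap

namespace Summit.HodgeConjecture.HodgeConjecture.Theorems

open Summit.HodgeConjecture.HodgeConjecture.Theses.SiuRepresentability

/-- **The split glue of `KaehlerRepresentable`, by name**: `IndecomposableRepresentable →
RepresentableCupHodge → KaehlerRepresentable` (strong induction on the codimension; Lefschetz `(1,1)`
for a first factor of codimension `1`, the induction hypothesis for codimension `≥ 2`, linearity of
the cup product). [cite: VoisinHodgeI2002, §11.3 and Thm. 11.30] [cite: VoisinHodgeII2003, §9.2.4 Prop. 9.20] -/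
theorem siuRepresentability_kaehlerRepresentableOfSectors : KaehlerRepresentableOfSectors := by
  intro h1 h2 n X hX hB p
  induction p using Nat.strong_induction_on with
  | _ p ih =>
  intro k hpk hp h2p c hc hh
  refine (Submodule.span_le.mpr ?_) (h1 hX hB p k hpk hp h2p c hc hh)
  rintro d (hd | hd)
  · exact Submodule.subset_span hd
  · obtain ⟨i, j, hij, hi, hj, a, b, ha, hha, hb, hhb, rfl⟩ := hd
    -- each factor lies in the span of the (algebraic ∪ Kähler-representable) classes of its codimension:
    -- codimension 1 by Lefschetz (1,1), codimension ≥ 2 by the induction hypothesis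
    have hfac : ∀ (i ki : ℕ) (hik : i + ki = n), 1 ≤ i → i < p →
        ∀ a : Literature.AlgebraicGeometry.HodgeTheory.complexBetti X (2 * i),
          Literature.AlgebraicGeometry.HodgeTheory.IsRationalClass a →
          Literature.AlgebraicGeometry.HodgeTheory.IsOfHodgeType n X (2 * i) i i a →
          a ∈ Submodule.span ℂ {a' : Literature.AlgebraicGeometry.HodgeTheory.complexBetti X (2 * i) |
            a' ∈ Literature.AlgebraicGeometry.HodgeTheory.algebraicClasses X i ∨
            ∃ (μX : Literature.AlgebraicTopology.SingularHomology.HomologicalOrientation ℂ (Literature.AlgebraicGeometry.Motives.ComplexPoints X) (2 * n)) (M : Literature.AlgebraicGeometry.Motives.SchemeOver ℂ) (_ : Literature.AlgebraicGeometry.Motives.IsSmoothProjective ki M) (μM : Literature.AlgebraicTopology.SingularHomology.HomologicalOrientation ℂ (Literature.AlgebraicGeometry.Motives.ComplexPoints M) (2 * ki)) (f : C(Literature.AlgebraicGeometry.Motives.ComplexPoints M, Literature.AlgebraicGeometry.Motives.ComplexPoints X)), Literature.AlgebraicTopology.SingularHomology.capProduct (show 2 * i + 2 * ki = 2 * n by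 omega) a' μX.fundamentalClass = Literature.AlgebraicTopology.SingularHomology.singularHomology.map ℂ ℂ f (2 * ki) μM.fundamentalClass} := by
      intro i ki hik hi hip a ha hha
      rcases Nat.lt_or_ge i 2 with hi2 | hi2
      · obtain rfl : i = 1 := by omega
        exact Submodule.subset_span (Or.inl (LefschetzOneOne_holds hX a ha hha))
      · exact Submodule.span_mono (fun x hx ↦ Or.inr hx) (ih i hip ki hik hi2 (by omega) a ha hha)
    have haS := hfac i (n - i) (by omega) hi (by omega) a ha hha
    have hbS : b ∈ Submodule.span ℂ {b' : Literature.AlgebraicGeometry.HodgeTheory.complexBetti X (2 * j) |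
        Literature.AlgebraicGeometry.HodgeTheory.IsRationalClass b' ∧
          Literature.AlgebraicGeometry.HodgeTheory.IsOfHodgeType n X (2 * j) j j b'} :=
      Submodule.subset_span ⟨hb, hhb⟩
    -- bilinearity of `∪`: the product lies in the span of the products of generators
    have hmem := Submodule.apply_mem_map₂
      (Literature.AlgebraicTopology.SingularHomology.cupProduct (show 2 * i + 2 * j = 2 * p by omega)) haS hbS
    rw [Submodule.map₂_span_span] at hmem
    refine (Submodule.span_le.mpr ?_) hmem
    rintro _ ⟨x, hx, y, ⟨hy, hhy⟩, rfl⟩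
    exact h2 hX hB i j p (n - i) k hij (by omega) hpk hi hj h2p x hx y hy hhy

end Summit.HodgeConjecture.HodgeConjecture.Theorems

end
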